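import Summits.BirchSwinnertonDyer.BirchSwinnertonDyer.Theorems.Rank2ObservatoryThreeIsoCensus
import Summits.BirchSwinnertonDyer.BirchSwinnertonDyer.Theorems.Rank2ObservatoryThreeIsoCensus2
import Summits.BirchSwinnertonDyer.BirchSwinnertonDyer.Theorems.Rank2ObservatoryThreeIsoCensus3
import Summits.BirchSwinnertonDyer.BirchSwinnertonDyer.Theorems.Rank2ObservatoryThreeIsoCensus4
import HarnessLib

/-!
# BirchSwinnertonDyer — rank ≥ 2 observatory: KERNEL-3ISO census, ALL parts (the 3539 curves of the `ℤ/3` stratum, `rank_ℤ = 2` hypothesis-free)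

HONEST FRAMING: per-curve certified theorems and census instruments; no claim on BSD in rank ≥ 2.

`threeIsoRowsAll` = `threeIsoRows ++ threeIsoRows2 ++ threeIsoRows3 ++ threeIsoRows4` = ALL 3539 rows of Cremona's rank-2 table
(`rank2Table`, conductors `N < 500000`; here `1862 ≤ N ≤ 499985`) with `E(ℚ)_tors = ℤ/3` — the complete `[3]` stratum of the KERNEL-3ISO
feasibility census (DATA provenance: `k3iso/CENSUS-3iso.tsv`, 3811 rows = 3539 `[3]` + 271 `[6]` + 1 `[2,6]`, sha256
`0a75c54d181e7f94f2e225b4ead17c27a7fe94f28abf4e7602809e88f17fc846`; the `[6]` / `[2,6]` rows are treated by 2-descent elsewhere and are NOT in this list).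
For EVERY row the upper bound `rank_ℤ ≤ 2` is a kernel theorem by explicit `3`-isogeny descent (Vélu pair `y² + 2m xy + 2s y = x³`,
E-side torsors `u X³ + Y³ + 2su Z³ − 2mu XYZ` killed over `ℚ_p`, Ê-side torsors killed over `K = ℚ(ζ₃)` by restriction of scalars,
Cohen–Pazuki Thm. 4.1; per-row files `Rank2Observatory<label>RankTwo.lean` with kernel-checked certificate lists — kits
`Rank2ObservatoryThreeIsoIndexLog|CertE|CertK|LiftE|NormFormE|LocalKillEhat`), and the lower bound `2 ≤ rank_ℤ` is the kernel point
certificate of the census table (`two_le_mordellWeilRank_of_mem_rank2Table`). Hence `forall_mem_threeIsoRowsAll_rank_eq_two`: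
`rank_ℤ E(ℚ) = 2` with NO hypothesis on all 3539 curves; `L(E,1) = L′(E,1) = 0` from `hGZK` alone; `r_an = rank_ℤ = 2` from `hGZK` + the
row's certificate field `hL2 : L″(E,1) ≠ 0`. Parts:
- `threeIsoRows` (435 rows, `Rank2ObservatoryThreeIsoCensus.lean`, cert-1 gen 9: E-side `2`-adic kills, Ê-side image full);
- `threeIsoRows2` (1570 rows, `Rank2ObservatoryThreeIsoCensus2.lean`, cert-1 gen 10, part 2);
- `threeIsoRows3` (807 rows, `Rank2ObservatoryThreeIsoCensus3.lean`, cert-1 gen 10/11, part 3);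
- `threeIsoRows4` (727 rows, `Rank2ObservatoryThreeIsoCensus4.lean`, cert-1 gen 10/11, part 4);
This file only concatenates the four census lists; no new mathematical content; axioms standard.
References: J. E. Cremona, *Algorithms for Modular Elliptic Curves* (2nd ed. 1997), Table 1, §2.13; H. Cohen, *Number Theory I*
(GTM 239), Prop. 8.4.8; H. Cohen, F. Pazuki, Acta Arith. 140 (2009), Prop. 2.2, Thm. 3.1, Thm. 4.1; H. Darmon (2004), Thm. 3.22.
-/

namespace Summit.BirchSwinnertonDyer.BirchSwinnertonDyer.Rank2Observatory

open WeierstrassCurve Literature.NumberTheory.EllipticCurves Literature.NumberTheory.EllipticCurves.MordellDescent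

/-- **The KERNEL-3ISO census list, all parts**: the 3539 rows of `rank2Table` with `E(ℚ)_tors = ℤ/3` (the `[3]` stratum of
`CENSUS-3iso.tsv`, sha256 `0a75c54d181e7f94…`). DATA. [cite: CremonaAlgorithms1997, Table 1] -/
def threeIsoRowsAll : List Rank2Row :=
  threeIsoRows ++ threeIsoRows2 ++ threeIsoRows3 ++ threeIsoRows4

/-- `threeIsoRowsAll` has `3539 = 435 + 1570 + 807 + 727` rows. [folklore] -/
theorem threeIsoRowsAll_length : threeIsoRowsAll.length = 3539 := by
  simp only [threeIsoRowsAll, List.length_append, threeIsoRows_length, threeIsoRows2_length, threeIsoRows3_length, threeIsoRows4_length]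

/-- Every row of `threeIsoRowsAll` is a row of the census table `rank2Table`. [folklore] -/
theorem forall_mem_threeIsoRowsAll_mem_rank2Table : ∀ r ∈ threeIsoRowsAll, r ∈ rank2Table := by
  intro r hr
  simp only [threeIsoRowsAll, List.mem_append, or_assoc] at hr
  rcases hr with h | h | h | h
  · exact forall_mem_threeIsoRows_mem_rank2Table r h
  · exact forall_mem_threeIsoRows2_mem_rank2Table r h
  · exact forall_mem_threeIsoRows3_mem_rank2Table r h
  · exact forall_mem_threeIsoRows4_mem_rank2Table r h

/-- **THE KERNEL-3ISO CENSUS THEOREM (whole `ℤ/3` stratum): `rank_ℤ E(ℚ) = 2` with NO hypothesis for every one of the 3539 rows of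
`threeIsoRowsAll`** (`hup` by explicit `3`-isogeny descent checked in the kernel, `hlow` by the kernel point certificate).
[cite: CremonaAlgorithms1997, Table 1] [cite: Cohen2007NumberTheoryI, Prop. 8.4.8] [cite: CohenPazuki2009, Prop. 2.2, Thm. 3.1, Thm. 4.1] -/
theorem forall_mem_threeIsoRowsAll_rank_eq_two : ∀ r ∈ threeIsoRowsAll, r.curve.mordellWeilRank = 2 := by
  intro r hr
  simp only [threeIsoRowsAll, List.mem_append, or_assoc] at hr
  rcases hr with h | h | h | h
  · exact forall_mem_threeIsoRows_rank_eq_two r h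
  · exact forall_mem_threeIsoRows2_rank_eq_two r h
  · exact forall_mem_threeIsoRows3_rank_eq_two r h
  · exact forall_mem_threeIsoRows4_rank_eq_two r h

/-- `L(E,1) = L′(E,1) = 0` EXACTLY for every row of `threeIsoRowsAll`, from `hGZK` alone. [cite: CremonaAlgorithms1997, §2.13] [cite: Darmon2004, Thm. 3.22] -/
theorem forall_mem_threeIsoRowsAll_lvalue_lderiv_eq_zero (hGZK : rank_eq_analyticRank_of_analyticRank_le_one) :
    ∀ r ∈ threeIsoRowsAll, r.curve.entireLFunction 1 = 0 ∧ deriv r.curve.entireLFunction 1 = 0 :=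
  fun r hr => lvalue_lderiv_eq_zero_of_mem_rank2Table (forall_mem_threeIsoRowsAll_mem_rank2Table r hr) hGZK

/-- **`r_an = rank_ℤ` and `r_an = 2` for every row of `threeIsoRowsAll`** given `hGZK` and the row's one remaining certificate
field `hL2 : L″(E,1) ≠ 0`. [cite: CremonaAlgorithms1997, §2.13] [cite: Darmon2004, Thm. 3.22] -/
theorem forall_mem_threeIsoRowsAll_analyticRank_eq_rank (hGZK : rank_eq_analyticRank_of_analyticRank_le_one) :
    ∀ r ∈ threeIsoRowsAll, iteratedDeriv 2 r.curve.entireLFunction 1 ≠ 0 →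
      r.curve.analyticRank = r.curve.mordellWeilRank ∧ r.curve.analyticRank = 2 :=
  fun r hr hL2 => analyticRank_eq_rank_of_mem_rank2Table (forall_mem_threeIsoRowsAll_mem_rank2Table r hr) hGZK
    (forall_mem_threeIsoRowsAll_rank_eq_two r hr).le hL2

end Summit.BirchSwinnertonDyer.BirchSwinnertonDyer.Rank2Observatory
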